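import Literature.Combinatorics.Sahi2008.SetPartitionForm
import Literature.Combinatorics.Sahi2008.Multilinear
import Literature.Combinatorics.Sahi2008.Symmetry

/-!
# The law of total cumulance for Sahi's `E_n` (conditioning / independent products), every `n`

Support file of the master-family programme (crux `NoHeavyLowerTail`, stmt-CriticalPhenomena-4575; cell `prim-masterthm`, seat P4, unit
`prim-masterthm-p4-g3`).  Vocabulary of `Literature/Combinatorics/Sahi2008`: `ex`, `sahiE` (Lieb–Sahi recursion [LiebSahi2021, Prop. 3.3]), and
the set partitions of `Fin n` as Mathlib's `OrderedFinpartition n` with blocks `PartitionForm.block c m` (`SetPartitionForm.lean`).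

THE IDENTITY (`sahiE_prod_eq_sum_partition`; finite types `γ` (inner variable `x`, weight `μ`) and `β` (outer variable `y`, weight `ν`),
ANY real weights, ANY `f_0,…,f_n : γ × β → ℝ`, product weight `(x,y) ↦ μ(x)ν(y)`):

  `E_{n+1}^{μ⊗ν}(f_0,…,f_n) = Σ_{π ∈ Part({0,…,n})} E^{ν}_{|π|}( (y ↦ E^{μ}_{|B|}(f_i(·,y) : i ∈ B)) : B ∈ π )`

— the OUTER functional (order = number of blocks) of the CONDITIONAL INNER functionals of the blocks (`condE μ f B : β → ℝ`).  This is
for Sahi's `E_n` what Brillinger's law of total cumulance is for classical cumulants; at `n + 1 = 2` it is the law of total covariance.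
Not found in print for `E_n` ([Sahi2008], [LiebSahi2021] give the set-partition / cycle form and the one-slot recursion); found and checked in
exact arithmetic by this seat (60 instances, `n + 1 ≤ 5`, signed weights) before the proof. [this work]
PROOF (`sum_termT_succ`): the right-hand side satisfies the Lieb–Sahi head recursion.  Split the set partitions of `{0,…,n+1}` by the block
of `0` (`OrderedFinpartition.extendEquiv`): at a singleton block `{0}` apply the OUTER recursion (its conditional functional is
`y ↦ E_x f_0(·,y)`, and `E^ν` of it is `E^{μ⊗ν} f_0`); at a block `{0} ∪ B` apply the INNER recursion pointwise in `y` and multilinearity of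
the outer functional; the cross terms `−E^ν(…,(E_x f_0)·E^μ(f_B),…)` of the two recursions cancel and the rest regroups (slot ↦ its block).
COROLLARIES (companion file `SahiMasterFamilyTensorisation.lean`): for product-form slots `φ_i(x)ψ_i(y)` every summand factors, so Sahi
positivity TENSORISES on product-form families (no FKG hypothesis on either factor) — containing the block stratum of the induction on
`k` (its one-slot case is the tree's independent splitting) and Sahi's cumulation theorem [Sahi2008, Thm. 2] for product measures.  For a
general monotone `f` the conditional inner functionals of blocks `|B| ≥ 2` are not monotone in `y`: the exact obstruction to "induction on
the dimension by conditioning" (MASTER-ROUTES §P4.4).  Nothing here is conjectural; no named facts.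
-/

noncomputable section

namespace Summit.CriticalPhenomena.PercolationContinuityZ3.Theorems

open Finset Function
open Literature.Combinatorics.Sahi2008
open Literature.Combinatorics.Sahi2008.PartitionForm

namespace SahiTotalCumulance

variable {γ β : Type*} [Fintype γ] [Fintype β]

/-! ### Conditional (inner) functionals of a block -/

/-- The `y`-sections of the slots in `S` (increasing enumeration of `S`), as a family of functions of the inner variable `x`.
[this work] -/
def secFam {N : ℕ} (f : Fin N → γ × β → ℝ) (S : Finset (Fin N)) (y : β) : Fin S.card → γ → ℝ :=
  fun j x => f (S.orderEmbOfFin rfl j) (x, y)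

/-- **Conditional inner functional of the block `S`**: `y ↦ E^μ_{|S|}(f_i(·,y) : i ∈ S)`. [this work] -/
def condE (μ : γ → ℝ) {N : ℕ} (f : Fin N → γ × β → ℝ) (S : Finset (Fin N)) : β → ℝ :=
  fun y => sahiE μ S.card (secFam f S y)

/-- The summand of the law of total cumulance for one set partition `c`: the outer functional of the conditional inner functionals
of its blocks. [this work] -/
def termT (μ : γ → ℝ) (ν : β → ℝ) {N : ℕ} (f : Fin N → γ × β → ℝ) (c : OrderedFinpartition N) : ℝ :=
  sahiE ν c.length (fun m => condE μ f (block c m))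

/-! ### Plumbing -/

omit [Fintype β] in
/-- Transport of `E_k` along a cast of the index type. [folklore] -/
theorem sahiE_cast' (μ : γ → ℝ) {k k' : ℕ} (h : k = k') (F : Fin k' → γ → ℝ) :
    sahiE μ k (fun j => F (Fin.cast h j)) = sahiE μ k' F := by
  subst h; rfl

omit [Fintype γ] [Fintype β] in
/-- The increasing enumeration of `S.map succ` is `succ ∘` (enumeration of `S`). [folklore] -/
theorem orderEmbOfFin_map_succ {n : ℕ} (S : Finset (Fin n)) (j : Fin S.card) :
    (S.map (Fin.succEmb n)).orderEmbOfFin (card_map _) j = Fin.succ (S.orderEmbOfFin rfl j) := by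
  have e : (fun j : Fin S.card => Fin.succ (S.orderEmbOfFin rfl j)) = (S.map (Fin.succEmb n)).orderEmbOfFin (card_map _) :=
    Finset.orderEmbOfFin_unique _
      (fun j => Finset.mem_map_of_mem (Fin.succEmb n) (Finset.orderEmbOfFin_mem S rfl j))
      ((Fin.strictMono_succ).comp (S.orderEmbOfFin rfl).strictMono)
  exact (congrFun e j).symm

omit [Fintype γ] [Fintype β] in
/-- Cardinality of `insert 0 (S.map succ)`. [folklore] -/
theorem card_insert_zero_map_succ {n : ℕ} (S : Finset (Fin n)) :
    (insert (0 : Fin (n + 1)) (S.map (Fin.succEmb n))).card = S.card + 1 := by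
  rw [card_insert_of_notMem (by simp), card_map]

omit [Fintype γ] [Fintype β] in
/-- The increasing enumeration of `insert 0 (S.map succ)` is `Fin.cons 0 (succ ∘ enumeration of S)`. [folklore] -/
theorem orderEmbOfFin_insert_zero_map_succ {n : ℕ} (S : Finset (Fin n)) (j : Fin (S.card + 1)) :
    (insert (0 : Fin (n + 1)) (S.map (Fin.succEmb n))).orderEmbOfFin (card_insert_zero_map_succ S) j =
      (Fin.cons (0 : Fin (n + 1)) (fun j : Fin S.card => Fin.succ (S.orderEmbOfFin rfl j)) : Fin (S.card + 1) → Fin (n + 1)) j := by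
  have e : (Fin.cons (0 : Fin (n + 1)) (fun j : Fin S.card => Fin.succ (S.orderEmbOfFin rfl j)) : Fin (S.card + 1) → Fin (n + 1)) =
      (insert (0 : Fin (n + 1)) (S.map (Fin.succEmb n))).orderEmbOfFin (card_insert_zero_map_succ S) := by
    refine Finset.orderEmbOfFin_unique _ (fun j => ?_) ?_
    · refine Fin.cases ?_ (fun j' => ?_) j
      · simp
      · simp only [Fin.cons_succ, mem_insert, Fin.succ_ne_zero, false_or]
        exact Finset.mem_map_of_mem (Fin.succEmb n) (Finset.orderEmbOfFin_mem S rfl j')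
    · intro a b hab
      revert hab
      refine Fin.cases ?_ (fun a' => ?_) a <;> refine Fin.cases ?_ (fun b' => ?_) b
      · intro h; exact absurd h (lt_irrefl _)
      · intro _; simp only [Fin.cons_zero, Fin.cons_succ]; exact Fin.succ_pos _
      · intro h; exact absurd h (by simp)
      · intro h; simp only [Fin.cons_succ]
        exact Fin.strictMono_succ ((S.orderEmbOfFin rfl).strictMono (Fin.succ_lt_succ_iff.mp h))
  exact (congrFun e j).symm

/-- **Sum over a block = sum over its increasing enumeration.** [folklore] -/
theorem sum_eq_sum_orderEmbOfFin {N : ℕ} (S : Finset (Fin N)) (φ : Fin N → ℝ) :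
    ∑ i ∈ S, φ i = ∑ j : Fin S.card, φ (S.orderEmbOfFin rfl j) := by
  have hmap : (univ : Finset (Fin S.card)).map (S.orderEmbOfFin rfl).toEmbedding = S := by
    apply eq_of_subset_of_card_le
    · intro i hi
      obtain ⟨j, _, rfl⟩ := mem_map.1 hi
      exact orderEmbOfFin_mem _ _ _
    · rw [card_map, card_univ, Fintype.card_fin]
  conv_lhs => rw [← hmap]
  rw [sum_map]; rfl

omit [Fintype γ] [Fintype β] in
/-- A point of block `m` has index `m`. [folklore] -/
theorem index_eq_of_mem_block {n : ℕ} (c : OrderedFinpartition n) {i : Fin n} {m : Fin c.length} (hi : i ∈ block c m) :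
    c.index i = m := by
  obtain ⟨r, hr⟩ := mem_block.1 hi
  by_contra h; exact c.emb_ne_emb_of_ne h ((c.emb_invEmbedding i).trans hr.symm)

omit [Fintype β] in
/-- The Lieb–Sahi recursion at the head, for any positive number of remaining slots. [folklore; LiebSahi2021 Prop. 3.3] -/
theorem sahiE_cons_rec (μ : γ → ℝ) {k : ℕ} (hk : 0 < k) (h : γ → ℝ) (g : Fin k → γ → ℝ) :
    sahiE μ (k + 1) (Fin.cons h g : Fin (k + 1) → γ → ℝ) =
      (∑ j : Fin k, sahiE μ k (update g j (g j * h))) - sahiE μ k g * ex μ h := by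
  obtain ⟨p, rfl⟩ : ∃ p, k = p + 1 := ⟨k - 1, by omega⟩
  exact sahiE_fin_cons μ p h g

omit [Fintype γ] in
/-- `E_n` is additive over finite sums in one slot. [folklore] -/
theorem sahiE_update_finsum (ν : β → ℝ) {L : ℕ} (G : Fin L → β → ℝ) (k : Fin L) {ι : Type*} (s : Finset ι)
    (B : ι → β → ℝ) :
    sahiE ν L (update G k (∑ j ∈ s, B j)) = ∑ j ∈ s, sahiE ν L (update G k (B j)) := by
  classical
  induction s using Finset.induction_on with
  | empty =>
    rw [sum_empty, sum_empty, show (0 : β → ℝ) = (0 : ℝ) • G k by simp, sahiE_update_smul, zero_mul]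
  | insert a s ha ih => rw [sum_insert ha, sum_insert ha, sahiE_update_add, ih]

omit [Fintype γ] in
/-- `E_n` respects subtraction in one slot. [folklore] -/
theorem sahiE_update_sub' (ν : β → ℝ) {L : ℕ} (G : Fin L → β → ℝ) (k : Fin L) (A C : β → ℝ) :
    sahiE ν L (update G k (A - C)) = sahiE ν L (update G k A) - sahiE ν L (update G k C) := by
  have h : A - C = (1 : ℝ) • A + (-1 : ℝ) • C := by funext y; simp [sub_eq_add_neg]
  rw [h, sahiE_update_lin]; ring

/-- **Fubini for the product weight**: `E^{μ⊗ν} h = E^ν_y E^μ_x h(x,y)`. [folklore] -/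
theorem ex_prod_weight (μ : γ → ℝ) (ν : β → ℝ) (h : γ × β → ℝ) :
    ex (fun p : γ × β => μ p.1 * ν p.2) h = ex ν (fun y => ex μ (fun x => h (x, y))) := by
  simp only [ex, Fintype.sum_prod_type, mul_sum]
  rw [sum_comm]
  exact sum_congr rfl fun y _ => sum_congr rfl fun x _ => by ring

/-! ### The conditional functionals of the blocks of the extended partitions -/

omit [Fintype β] in
/-- Sections over a block shifted by `succ` are the sections of `tail f` over the block. [this work] -/
theorem condE_map_succ (μ : γ → ℝ) {n : ℕ} (F : Fin (n + 2) → γ × β → ℝ) (S : Finset (Fin (n + 1))) :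
    condE μ F (S.map (Fin.succEmb (n + 1))) = condE μ (Fin.tail F) S := by
  funext y
  unfold condE secFam
  have hc : S.card = (S.map (Fin.succEmb (n + 1))).card := (card_map _).symm
  rw [← sahiE_cast' μ hc]
  congr 1
  funext j x
  have e1 : (S.map (Fin.succEmb (n + 1))).orderEmbOfFin rfl (Fin.cast hc j)
      = (S.map (Fin.succEmb (n + 1))).orderEmbOfFin (card_map _) j :=
    Finset.orderEmbOfFin_eq_orderEmbOfFin_iff.mpr rfl
  rw [e1, orderEmbOfFin_map_succ]
  rfl

omit [Fintype β] in
/-- The block `{0}`: its conditional functional is the conditional mean `y ↦ E^μ_x f_0(x,y)`. [this work] -/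
theorem condE_singleton_zero (μ : γ → ℝ) {n : ℕ} (F : Fin (n + 1) → γ × β → ℝ) (y : β) :
    condE μ F {(0 : Fin (n + 1))} y = ex μ (fun x => F 0 (x, y)) := by
  unfold condE secFam
  have hc : 1 = ({(0 : Fin (n + 1))} : Finset (Fin (n + 1))).card := (card_singleton _).symm
  rw [← sahiE_cast' μ hc, sahiE_one_apply]
  have e1 : ({(0 : Fin (n + 1))} : Finset (Fin (n + 1))).orderEmbOfFin rfl (Fin.cast hc 0)
      = ({(0 : Fin (n + 1))} : Finset (Fin (n + 1))).orderEmbOfFin (card_singleton _) 0 :=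
    Finset.orderEmbOfFin_eq_orderEmbOfFin_iff.mpr rfl
  show ex μ (fun x => F (({(0 : Fin (n + 1))} : Finset (Fin (n + 1))).orderEmbOfFin rfl (Fin.cast hc 0)) (x, y)) = _
  rw [e1, Finset.orderEmbOfFin_singleton]

omit [Fintype β] in
/-- The block `{0} ∪ succ(S)`: its conditional functional is the inner functional with `f_0(·,y)` consed to the sections of `tail f`
over `S`. [this work] -/
theorem condE_insert_zero_map_succ (μ : γ → ℝ) {n : ℕ} (F : Fin (n + 2) → γ × β → ℝ) (S : Finset (Fin (n + 1))) (y : β) :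
    condE μ F (insert 0 (S.map (Fin.succEmb (n + 1)))) y =
      sahiE μ (S.card + 1) (Fin.cons (fun x => F 0 (x, y)) (secFam (Fin.tail F) S y) : Fin (S.card + 1) → γ → ℝ) := by
  unfold condE
  have hc : S.card + 1 = (insert (0 : Fin (n + 2)) (S.map (Fin.succEmb (n + 1)))).card :=
    (card_insert_zero_map_succ S).symm
  rw [← sahiE_cast' μ hc]
  congr 1
  funext j x
  unfold secFam
  have e1 : (insert (0 : Fin (n + 2)) (S.map (Fin.succEmb (n + 1)))).orderEmbOfFin rfl (Fin.cast hc j)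
      = (insert (0 : Fin (n + 2)) (S.map (Fin.succEmb (n + 1)))).orderEmbOfFin (card_insert_zero_map_succ S) j :=
    Finset.orderEmbOfFin_eq_orderEmbOfFin_iff.mpr rfl
  rw [e1, orderEmbOfFin_insert_zero_map_succ]
  refine Fin.cases ?_ (fun j' => ?_) j
  · simp
  · simp [Fin.tail]

omit [Fintype β] in
/-- Updating a slot outside the block does not change the block's conditional functional. [this work] -/
theorem condE_update_of_not_mem (μ : γ → ℝ) {N : ℕ} (g : Fin N → γ × β → ℝ) (S : Finset (Fin N)) {i : Fin N}
    (hi : i ∉ S) (h : γ × β → ℝ) : condE μ (update g i h) S = condE μ g S := by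
  funext y
  unfold condE secFam
  congr 1
  funext j x
  have hne : S.orderEmbOfFin rfl j ≠ i := fun heq => hi (heq ▸ orderEmbOfFin_mem _ _ _)
  rw [update_of_ne hne]

omit [Fintype γ] [Fintype β] in
/-- Updating the slot enumerated `j`-th in the block updates the `j`-th section. [this work] -/
theorem secFam_update_of_eq {N : ℕ} (g : Fin N → γ × β → ℝ) (S : Finset (Fin N)) (j : Fin S.card)
    (h : γ × β → ℝ) (y : β) :
    secFam (update g (S.orderEmbOfFin rfl j) h) S y = update (secFam g S y) j (fun x => h (x, y)) := by
  funext j' x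
  unfold secFam
  by_cases hj : j' = j
  · subst hj
    rw [update_self, update_self]
  · have hne : S.orderEmbOfFin rfl j' ≠ S.orderEmbOfFin rfl j :=
      fun heq => hj ((S.orderEmbOfFin rfl).injective heq)
    rw [update_of_ne hne, update_of_ne hj]

/-! ### The summands for the extended partitions -/

/-- **Singleton block `{0}`.**  For `π = {0} ∪ (c + 1)`, the outer family is `Fin.cons (y ↦ E_x f_0) (blocks of c for tail f)`. [this work] -/
theorem termT_extendLeft (μ : γ → ℝ) (ν : β → ℝ) {n : ℕ} (F : Fin (n + 2) → γ × β → ℝ) (c : OrderedFinpartition (n + 1)) :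
    termT μ ν F c.extendLeft =
      sahiE ν (c.length + 1)
        (Fin.cons (fun y => ex μ (fun x => F 0 (x, y))) (fun m => condE μ (Fin.tail F) (block c m)) :
          Fin (c.length + 1) → β → ℝ) := by
  unfold termT
  show sahiE ν (c.length + 1) (fun m : Fin (c.length + 1) => condE μ F (block c.extendLeft m)) = _
  congr 1
  funext m
  refine Fin.cases ?_ (fun m' => ?_) m
  · rw [Fin.cons_zero, block_extendLeft_zero]
    funext y
    exact condE_singleton_zero μ F y
  · rw [Fin.cons_succ, block_extendLeft_succ, condE_map_succ]

/-- **`0` inserted into block `k`.**  The outer family is that of `c` for `tail f` with slot `k` replaced by the conditional functional of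
`{0} ∪ succ(block k)`; by the INNER recursion and multilinearity,
`termT(F, c.extendMiddle k) = Σ_{j} E^ν(…, condE(F with slot e_k(j) absorbing F_0, block k), …) − E^ν(…, condE(tail F, block k)·(E_x F_0), …)`.
[this work] -/
theorem termT_extendMiddle (μ : γ → ℝ) (ν : β → ℝ) {n : ℕ} (F : Fin (n + 2) → γ × β → ℝ) (c : OrderedFinpartition (n + 1))
    (k : Fin c.length) :
    termT μ ν F (c.extendMiddle k) =
      (∑ j : Fin (block c k).card,
          sahiE ν c.length (update (fun m => condE μ (Fin.tail F) (block c m)) k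
            (condE μ (update (Fin.tail F) ((block c k).orderEmbOfFin rfl j)
              (Fin.tail F ((block c k).orderEmbOfFin rfl j) * F 0)) (block c k))))
      - sahiE ν c.length (update (fun m => condE μ (Fin.tail F) (block c m)) k
          ((fun m => condE μ (Fin.tail F) (block c m)) k * fun y => ex μ (fun x => F 0 (x, y)))) := by
  unfold termT
  show sahiE ν c.length (fun m : Fin c.length => condE μ F (block (c.extendMiddle k) m)) = _
  -- the outer family is an update at slot `k`
  have hfam : (fun m : Fin c.length => condE μ F (block (c.extendMiddle k) m)) =
      update (fun m => condE μ (Fin.tail F) (block c m)) k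
        (condE μ F (insert 0 ((block c k).map (Fin.succEmb (n + 1))))) := by
    funext m
    by_cases hm : m = k
    · subst hm
      rw [update_self, block_extendMiddle_self]
    · rw [update_of_ne hm, block_extendMiddle_ne c k hm, condE_map_succ]
  rw [hfam]
  -- the inner recursion, pointwise in `y`
  have hinner : condE μ F (insert 0 ((block c k).map (Fin.succEmb (n + 1)))) =
      (∑ j : Fin (block c k).card,
          condE μ (update (Fin.tail F) ((block c k).orderEmbOfFin rfl j)
            (Fin.tail F ((block c k).orderEmbOfFin rfl j) * F 0)) (block c k))
        - (fun m => condE μ (Fin.tail F) (block c m)) k * fun y => ex μ (fun x => F 0 (x, y)) := by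
    funext y
    rw [condE_insert_zero_map_succ,
      sahiE_cons_rec μ (by rw [card_block]; exact c.partSize_pos k)]
    simp only [Pi.sub_apply, Finset.sum_apply, Pi.mul_apply]
    congr 1
    refine sum_congr rfl fun j _ => ?_
    unfold condE
    rw [secFam_update_of_eq]
    rfl
  rw [hinner, sahiE_update_sub', sahiE_update_finsum]

/-- **The summand for a family with slot `i` absorbing `F_0`**: only the block of `i` changes. [this work] -/
theorem termT_update (μ : γ → ℝ) (ν : β → ℝ) {n : ℕ} (F : Fin (n + 2) → γ × β → ℝ) (c : OrderedFinpartition (n + 1))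
    (i : Fin (n + 1)) :
    termT μ ν (update (Fin.tail F) i (Fin.tail F i * F 0)) c =
      sahiE ν c.length (update (fun m => condE μ (Fin.tail F) (block c m)) (c.index i)
        (condE μ (update (Fin.tail F) i (Fin.tail F i * F 0)) (block c (c.index i)))) := by
  unfold termT
  congr 1
  funext m
  by_cases hm : m = c.index i
  · subst hm
    rw [update_self]
  · rw [update_of_ne hm]
    have hi : i ∉ block c m := fun h => hm (index_eq_of_mem_block c h).symm
    rw [condE_update_of_not_mem μ _ _ hi]

/-- **Regrouping the slots by their blocks**: `Σ_i termT(F with slot i absorbing F_0, c) = Σ_k Σ_{j ∈ block k} …`. [this work] -/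
theorem sum_termT_update (μ : γ → ℝ) (ν : β → ℝ) {n : ℕ} (F : Fin (n + 2) → γ × β → ℝ) (c : OrderedFinpartition (n + 1)) :
    ∑ i : Fin (n + 1), termT μ ν (update (Fin.tail F) i (Fin.tail F i * F 0)) c =
      ∑ k : Fin c.length, ∑ j : Fin (block c k).card,
        sahiE ν c.length (update (fun m => condE μ (Fin.tail F) (block c m)) k
          (condE μ (update (Fin.tail F) ((block c k).orderEmbOfFin rfl j)
            (Fin.tail F ((block c k).orderEmbOfFin rfl j) * F 0)) (block c k))) := by
  simp_rw [termT_update]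
  rw [← sum_fiberwise univ c.index (fun i : Fin (n + 1) =>
      sahiE ν c.length (update (fun m => condE μ (Fin.tail F) (block c m)) (c.index i)
        (condE μ (update (Fin.tail F) i (Fin.tail F i * F 0)) (block c (c.index i)))))]
  refine sum_congr rfl fun k _ => ?_
  have hfilter : (univ.filter fun i : Fin (n + 1) => c.index i = k) = block c k := rfl
  rw [hfilter, sum_eq_sum_orderEmbOfFin]
  refine sum_congr rfl fun j _ => ?_
  have hidx : c.index ((block c k).orderEmbOfFin rfl j) = k :=
    index_eq_of_mem_block c (orderEmbOfFin_mem _ _ _)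
  rw [hidx]

/-! ### The recursion for the right-hand side, and the theorem -/

/-- Base: one slot. [this work] -/
theorem sum_termT_one (μ : γ → ℝ) (ν : β → ℝ) (f : Fin 1 → γ × β → ℝ) :
    ∑ c : OrderedFinpartition 1, termT μ ν f c = ex (fun p : γ × β => μ p.1 * ν p.2) (f 0) := by
  rw [Fintype.sum_unique, OrderedFinpartition.default_eq, ex_prod_weight]
  unfold termT
  have key : ∀ G : Fin (OrderedFinpartition.atomic 1).length → β → ℝ,
      sahiE ν (OrderedFinpartition.atomic 1).length G = ex ν (G ⟨0, by simp⟩) := by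
    intro G
    exact sahiE_one_apply ν G
  rw [key]
  congr 1
  funext y
  have hblock : block (OrderedFinpartition.atomic 1) ⟨0, by simp⟩ = {0} := by
    apply eq_of_subset_of_card_le
    · intro i _; rw [mem_singleton]; exact Subsingleton.elim i 0
    · rw [card_block, card_singleton]; rfl
  rw [hblock]
  exact condE_singleton_zero μ f y

/-- **The right-hand side satisfies the Lieb–Sahi recursion in the head slot.** [this work] -/
theorem sum_termT_succ (μ : γ → ℝ) (ν : β → ℝ) {n : ℕ} (F : Fin (n + 2) → γ × β → ℝ) :
    ∑ c' : OrderedFinpartition (n + 2), termT μ ν F c' =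
      (∑ i : Fin (n + 1), ∑ c : OrderedFinpartition (n + 1), termT μ ν (update (Fin.tail F) i (Fin.tail F i * F 0)) c) -
        (∑ c : OrderedFinpartition (n + 1), termT μ ν (Fin.tail F) c) * ex (fun p : γ × β => μ p.1 * ν p.2) (F 0) := by
  rw [← Fintype.sum_equiv (OrderedFinpartition.extendEquiv (n + 1)) (fun p => termT μ ν F (p.1.extend p.2))
    (fun c' => termT μ ν F c') (fun p => rfl), Fintype.sum_sigma]
  simp_rw [Fintype.sum_option, OrderedFinpartition.extend_none, OrderedFinpartition.extend_some, termT_extendLeft,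
    termT_extendMiddle]
  -- outer recursion at the singleton block
  have hleft : ∀ c : OrderedFinpartition (n + 1),
      sahiE ν (c.length + 1)
          (Fin.cons (fun y => ex μ (fun x => F 0 (x, y))) (fun m => condE μ (Fin.tail F) (block c m)) :
            Fin (c.length + 1) → β → ℝ) =
        (∑ k : Fin c.length, sahiE ν c.length (update (fun m => condE μ (Fin.tail F) (block c m)) k
            ((fun m => condE μ (Fin.tail F) (block c m)) k * fun y => ex μ (fun x => F 0 (x, y)))))
          - termT μ ν (Fin.tail F) c * ex (fun p : γ × β => μ p.1 * ν p.2) (F 0) := by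
    intro c
    rw [sahiE_cons_rec ν (c.length_pos (Nat.succ_pos n)), ex_prod_weight]
    rfl
  simp_rw [hleft]
  rw [sum_comm, sum_mul]
  simp_rw [sum_termT_update]
  rw [← sum_sub_distrib]
  refine sum_congr rfl fun c _ => ?_
  rw [Finset.sum_sub_distrib]
  ring

/-- **THE LAW OF TOTAL CUMULANCE FOR SAHI'S FUNCTIONAL** (every `n`, any real weights `μ` on `γ` and `ν` on `β`, any functions on
`γ × β` under the product weight `(x,y) ↦ μ(x)ν(y)`):
`E_{n+1}^{μ⊗ν}(f) = Σ_{π ∈ Part({0..n})} E^ν_{|π|}( y ↦ E^μ_{|B|}(f_B(·,y)) : B ∈ π )`. [this work] -/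
theorem sahiE_prod_eq_sum_partition (μ : γ → ℝ) (ν : β → ℝ) :
    ∀ (n : ℕ) (f : Fin (n + 1) → γ × β → ℝ),
      sahiE (fun p : γ × β => μ p.1 * ν p.2) (n + 1) f = ∑ c : OrderedFinpartition (n + 1), termT μ ν f c
  | 0, f => by rw [sum_termT_one, sahiE_one_apply]
  | n + 1, f => by
    rw [sum_termT_succ, sahiE_succ_succ, sahiE_prod_eq_sum_partition μ ν n (Fin.tail f)]
    congr 1
    refine sum_congr rfl fun i _ => ?_
    exact sahiE_prod_eq_sum_partition μ ν n _

end SahiTotalCumulance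

end Summit.CriticalPhenomena.PercolationContinuityZ3.Theorems

end
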